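import Summits.BirchSwinnertonDyer.BirchSwinnertonDyer.Theses.DefiniteGrossPeriodAtTwo
import Summits.BirchSwinnertonDyer.BirchSwinnertonDyer.Theses.ByReductionTypeAtTwo
import Summits.BirchSwinnertonDyer.BirchSwinnertonDyer.Theorems.ByReductionTypeAtTwoAdditivePotGoodKatoHalf
import Literature.NumberTheory.EllipticCurves.NonEisensteinPrimeOfSurjective
import Literature.NumberTheory.EllipticCurves.AnalyticRankOrderProofs
import Literature.NumberTheory.EllipticCurves.BSDRootNumberSmallConductorProofs
import HarnessLib

/-!
# SKELETON LINE `additive_twist_cells` for crux 22973 `AdditiveKatoBoundAtTwoBigImage` (route DefiniteGrossPeriodAtTwo, r404)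

line-writer skeleton (linewriter-bsd-wide-1 g0); NOT leaf progress. The additive-at-2 big-image CELL of the Kato bound
(`Finite Ш[2^∞] ∧ ord₂ #Ш(E)[2^∞] ≤ ord₂ #Ш_an(E)`, E non-CM of analytic rank 0, ρ̄_{E,2} surjective, −Δ non-square, ADDITIVE at 2)
FOLLOWS from THREE of the five children of the sibling crux 19098 `ByReductionTypeAtTwo.AdditiveRankZeroAtTwo` plus its print
bundle — and NOT from its Eisenstein/lower half (22617) NOR its reducible rest (22616): big image makes E[2] irreducible, and the
cell only wants the Kato half. Split by POTENTIAL reduction type (sign of ord₂ j):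
* ord₂ j ≥ 0 (potentially good): stub 1 = 22615 `FineSelmerConjAAtTwoAdditivePotGood` BY NAME (Coates–Sujatha Conjecture A at 2
  on the non-abelian-ℚ(E[2]) part — under surjective ρ̄₂ the 2-division field has group S₃, so the cell sits INSIDE 22615's scope;
  the abelian part is print: Lim 2017 Thm 3.5@2 + Ferrero–Washington, `addPotGood_conjA_two_of_nonAbelian`) ⟹ Kato's SHARP p = 2
  fine-Selmer reading (`padicValNat_shaOrder_le_of_katoFineSelmerAtTwoSharp_rankZero`, torsion term 0 by irreducibility) ⟹
  the upper bound in Miller currency;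
* ord₂ j < 0 (potentially multiplicative): TWIST TRANSPORT — stub 2 = 22618 `AdditivePotMultOverKAtTwo` BY NAME (C-part of BSD₂
  over a quadratic K semistabilising W at 2) + stub 3 = the sibling 19096 `MultiplicativeRankZeroAtTwo` BY NAME (BSD₂ of the
  multiplicative twist W^(d_K); split on BRT with proved glue) ⟹ BSD₂(W) by Hoffstein–Luo + Milne's any-model Weil restriction
  (`addPotMult_bsdp_two_of_mult_of_overKC`) ⟹ the cell's inequality (equality is stronger).
Stub 4 = 22619 `AdditivePrintedInputsAtTwo` BY NAME (11 print heads). Composition PROVED (case split on ord₂ j; irreducibility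
from surjectivity; GZK finiteness; `padicValNat_card_addPrimaryComponent` into the parent's 2-primary currency). So: closing
22615 ∧ 22618 ∧ 19096 on route ByReductionTypeAtTwo closes this cell here — ONE READER, minus the two children big image spares.
The alternative road (Matsuno 2008 Thm 5.1 at the ramified twist over ℚ_∞ / a new additive-at-2 Selmer condition, crux
docstring) would replace stub 1; it has no typed consumer yet and is NOT used. Sorries ONLY inside `stub_*`; nothing asserted.
-/

set_option autoImplicit false

namespace Summit.BirchSwinnertonDyer.BirchSwinnertonDyer.Cruxes.AdditiveKatoBoundAtTwoBigImage.AdditiveTwistCells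

open WeierstrassCurve Literature.NumberTheory.EllipticCurves Literature.NumberTheory.EllipticCurves.Rank1Residual
  Literature.NumberTheory.EllipticCurves.Rank1Residual.Typed Summit.BirchSwinnertonDyer.Rank1Residual
  Summit.BirchSwinnertonDyer.BirchSwinnertonDyer.Theses.ByReductionTypeAtTwo
  Summit.BirchSwinnertonDyer.BirchSwinnertonDyer.Theorems.AddKatoTwo

/-- [research] stub 1 = item stmt-BirchSwinnertonDyer-22615 `ByReductionTypeAtTwo.FineSelmerConjAAtTwoAdditivePotGood` BY NAME (crux r501 on BRT:
Coates–Sujatha Conjecture A at p = 2 — fine Selmer dual finitely generated over ℤ₂ along ℚ_cyc — for the additive potentially-good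
rank-0 curves with NON-ABELIAN 2-division field; the big-image cell lies inside this scope). -/
theorem stub_fineSelmerConjAAtTwoAdditivePotGood : FineSelmerConjAAtTwoAdditivePotGood := by
  sorry

/-- [research] stub 2 = item stmt-BirchSwinnertonDyer-22618 `ByReductionTypeAtTwo.AdditivePotMultOverKAtTwo` BY NAME (crux r504 on BRT: the
C-part of BSD₂ over a quadratic K semistabilising W at 2, potentially multiplicative class; Tamagawa/period bookkeeping at a
ramified even place is the beyond-print step). -/
theorem stub_additivePotMultOverKAtTwo : AdditivePotMultOverKAtTwo := by
  sorry

/-- [research] stub 3 = item stmt-BirchSwinnertonDyer-19096 `ByReductionTypeAtTwo.MultiplicativeRankZeroAtTwo` BY NAME (the multiplicative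
sibling, SPLIT on BRT into 19921/19922/19923 with proved glue 19924: BSD₂ of the semistable twist is needed IN FULL — both halves —
for the twist transport). -/
theorem stub_multiplicativeRankZeroAtTwo : MultiplicativeRankZeroAtTwo := by
  sorry

/-- [print: GrossZagier1986 + Kolyvagin1990Euler (GZK); BreuilConradDiamondTaylor2001 Thm. A; Milne1972ArithmeticAV Thm. 1; HoffsteinLuo1997 Theorem; Lim2017FineSelmer Thm. 3.5; FerreroWashington1979; Kato2004Asterisque Thm. 12.5/13.8/14.14 (sharp p = 2 reading, D-audit PASS); Cassels1965ArithmeticVIII] stub 4 = item stmt-BirchSwinnertonDyer-22619 `ByReductionTypeAtTwo.AdditivePrintedInputsAtTwo` BY NAME (support r505: GZK,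
modularity, Milne 1972, Hoffstein–Luo, Lim 2017@2, Ferrero–Washington, Kato-at-2 SHARP reading, newform, member package, Cassels,
Cassels–Tate — PRINT, cite-only heads). -/
theorem stub_additivePrintedInputsAtTwo : AdditivePrintedInputsAtTwo := by
  sorry

/-- **Composition (kernel-checked, no binders): `AdditiveKatoBoundAtTwoBigImage`** = the route decl
`Theses.DefiniteGrossPeriodAtTwo.AdditiveKatoBoundAtTwoBigImage` (item 22973, LINE 12′ cell r404) BY NAME.
[cite: Kato2004Asterisque, Thm. 12.5, 13.8, 14.14] [cite: CoatesSujatha2005, Conj. A] [cite: Lim2017FineSelmer, Thm. 3.5]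
[cite: FerreroWashington1979] [cite: Milne1972ArithmeticAV, Thm. 1] [cite: HoffsteinLuo1997] [cite: Miller2011LMS, Def. 1.1] -/
theorem AdditiveKatoBoundAtTwoBigImage_of :
    Summit.BirchSwinnertonDyer.BirchSwinnertonDyer.Theses.DefiniteGrossPeriodAtTwo.AdditiveKatoBoundAtTwoBigImage := by
  have hAna := stub_fineSelmerConjAAtTwoAdditivePotGood
  have hQKm := stub_additivePotMultOverKAtTwo
  have hMult := stub_multiplicativeRankZeroAtTwo
  obtain ⟨hGZK, hmod, hMilneC, hHL, hLim2, hFW, hSharp, _hmodN, _hin, _hCassels, _hCT⟩ := stub_additivePrintedInputsAtTwo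
  intro W _ _ hcm hs _hnsq hr hadd
  haveI : Fact (Nat.Prime 2) := ⟨Nat.prime_two⟩
  haveI hfin : Finite W.sha := (hGZK W (by omega)).2
  by_cases hj : 0 ≤ padicValRat 2 W.j
  · -- potentially good: Conjecture A (stub 1, abelian part from print) + Kato's sharp p = 2 reading, torsion term 0
    have hirr : W.HasIrreducibleModPGaloisRep 2 :=
      Literature.NumberTheory.EllipticCurves.hasIrreducibleModPGaloisRep_of_hasSurjectiveModNGaloisRep W 2 hs
    have hA := addPotGood_conjA_two_of_nonAbelian hLim2 hFW hAna W hcm hr hadd hj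
    obtain ⟨q, hq, hle⟩ :=
      padicValNat_shaOrder_le_of_katoFineSelmerAtTwoSharp_rankZero hSharp hGZK hmod W hcm hadd.1 hadd.2 hj hirr hA hr
    rw [padicValNat_torsionOrder_eq_zero_of_irreducible W 2 hirr] at hle
    simp only [Nat.cast_zero, mul_zero, sub_zero] at hle
    refine ⟨Finite.of_injective _ Subtype.val_injective, q, hq, ?_⟩
    rw [Literature.NumberTheory.EllipticCurves.padicValNat_card_addPrimaryComponent]
    simpa [WeierstrassCurve.shaOrder] using hle
  · -- potentially multiplicative: twist transport through the multiplicative sibling (stubs 2, 3)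
    have hj' : padicValRat 2 W.j < 0 := lt_of_not_ge hj
    have hB : BSDp W 2 := addPotMult_bsdp_two_of_mult_of_overKC hGZK hmod hMilneC hHL hMult hQKm W hcm hr hadd hj'
    obtain ⟨_, hfin2, q, hq, heq⟩ := hB
    exact ⟨hfin2, q, hq, by rw [heq]⟩

end Summit.BirchSwinnertonDyer.BirchSwinnertonDyer.Cruxes.AdditiveKatoBoundAtTwoBigImage.AdditiveTwistCells
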